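import Summits.QuantumFields.YangMills.Theorems.UnitScaleTiltProp7LatticeBoxFriedrichsCov
import Literature.MathematicalPhysics.QuantumFieldTheory.Balaban1983to89.B8Lemma1NonAbelian
import HarnessLib

/-!
# Route `UnitScaleTilt`, crux K1 «MinimiserStabilityRegPr» (stmt-QuantumFields-19200) — route-R E′ (A′), (N06) row `hN06`, LANE II «DIVERGENCE RECOVERY AT CURVED W»
# (★★OWNER g29 RULING №23 (c): §4 box bricks → px4; skeleton §4 (B1′) `boxFriedrichs_curved`), part 2∕2 of (B1′):
# **THE COVARIANT BOX FRIEDRICHS INEQUALITY FROM THE PLAQUETTE BOUND** — gauge covariance + the axial gauge at the box corner (lit ✓`B8Lemma1NonAbelian.axial_bond_bound_sharp`):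
# `Σ‖g‖² ≤ N(2R+1)²·(3∕2·CURL^V_inside + 2·DIV^V_box) + 80·d³·N·(2R+1)²·R²·α²·Σ‖g‖²` for a unitary background whose box plaquettes are `α`-close to `1`

Cell `ym3-torus`, width seat `ym3-torus-px4` (gen 7).  THEOREMS ONLY (0 `def`, 0 `sorry`); `--supports stmt-QuantumFields-19200 --as helper`, count-neutral; consumer-independent.  YM₃ on T³
is a ladder rung (R3), not d = 4, not infinite volume, not the Clay problem; nothing here claims [Balaban1985BackgroundPropagators] Thm 3.3 ∕ 3.11, `hN06`, (REC), E′, EX, H, the crux or the gap.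

THE PRINT.  [Balaban1985Averaging] pp.24–25 «`|V₀,b − 1| < |b₋ − y|α₀`» (the axial gauge of a background with small plaquette variables has small bond variables, linearly in the distance
to the base point); [Balaban1985RegularSpaces] (1.7) p.77 (the plaquette clause); [Balaban1985BackgroundPropagators] (3.8)–(3.9) p.392 (covariant derivative and curl).

WHAT IS PROVED (ns `…Theorems.Prop7LatticeBoxFriedrichsCurved`; letters = part 1∕2 + lit `B8Lemma1NonAbelian.PlaqSmall`, `B7Prop1Explicit.axialFn`∕`gaugeAct`∕`l1`):
* §1 gauge covariance: with `u := axialFn V lo`, `V₀ := gaugeAct u V`, `g₀ y μ := R(u y)(g y μ)` — `norm_gauged` (`‖g₀‖ = ‖g‖`), ★`covCurl_gauged` (`cov-curl_{V₀} g₀ = R(u y)(cov-curl_V g)`),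
  ★`covDiv_gauged` (`cov-div_{V₀} g₀ = R(u y)(cov-div_V g)`) — pure algebra over lit ✓`conjR_conjR`.
* §2 the bond bound in the box: `mem_box_iff_le` (`Q_R(z) = [z − R, z + R]`), ★`norm_axial_sub_one_le_of_plaqSmall` (`‖V₀ y μ − 1‖ ≤ 2dR·α` on the box bonds, from ✓`axial_bond_bound_sharp`).
* §3 ★★★`sum_sq_le_box_friedrichs_plaq` — THE (B1′) BRICK: for `0 ≤ R`, `V` unitary with `PlaqSmall V (z − R) (z + R) α`, `0 ≤ α`, `g` living on the edges of `Q_R(z)`: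
  `Σ_{Q_R}Σ_μ‖g y μ‖² ≤ N(2R+1)²·((3∕2)·Σ_{Q_R}Σ_μΣ_ν [y+e_μ+e_ν ∈ Q_R]·‖cov-curl_V g‖² + 2·Σ_{Q_R}‖cov-div_V g‖²) + 80·d³·N·(2R+1)²·R²·α²·Σ_{Q_R}Σ_μ‖g y μ‖²`
  (= part 1∕2's ✓`sum_sq_le_box_friedrichs_cov` at `(V₀, g₀)` with `θ = 2dR·α`, transported back by §1) — the skeleton's `CF·M²·(CURL + DIV) + CF′·(M²α)²·Σ‖g‖²` with ABSOLUTE constants.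
HONEST SCOPE.  Lattice gauge bookkeeping over landed lit∕tree lemmas; nothing of print asserted; rung R3, not Clay; YM gap NOT proved.

References: T. Bałaban, CMP **98** (1985) 17–51 [Balaban1985Averaging] (pp.24–25); CMP **99** (1985) 75–102 [Balaban1985RegularSpaces] ((1.7) p.77); CMP **99** (1985) 389–434
[Balaban1985BackgroundPropagators] ((3.8)–(3.9) p.392); CMP **95** (1984) 17–40 [Balaban1984PropagatorsI] (Prop. 1.1 p.33).
-/

set_option autoImplicit false

noncomputable section

open scoped BigOperators Matrix.Norms.L2Operator
open Finset

namespace Summit.QuantumFields.YangMills.Theorems.Prop7LatticeBoxFriedrichsCurved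

open Literature.MathematicalPhysics.QuantumFieldTheory.Balaban1983to89
open Literature.MathematicalPhysics.QuantumFieldTheory.Balaban1983to89.B4Eq19LatticeOperators
open B7Prop1Explicit (U1 gaugeAct axialFn l1 gaugeAct_mem axialFn_mem)
open B7Eq78Linearization (conjR conjR_apply conjR_sub conjR_add)
open B8Ineq132 (norm_conjR conjR_conjR one_conjR conjR_sum)
open B8Lemma1NonAbelian (PlaqSmall lowPart axial_bond_bound_sharp)
open Summit.QuantumFields.YangMills.Theorems.Prop7LatticeBoxFriedrichsCov (sum_sq_le_box_friedrichs_cov)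

variable {d N : ℕ}

/-! ## §1 Gauge covariance of the three quantities -/

section Gauge

/-- `unitVec μ` (lit `B4Eq19LatticeOperators`) is lit `B7Prop1Explicit.e μ`. [folklore] -/
theorem unitVec_eq_e (μ : Fin d) : (unitVec μ : Zd d) = B7Prop1Explicit.e μ := rfl

/-- The transport at a gauged bond: `R(V₀ y μ)(R(u(y+e_μ))X) = R(u y)(R(V y μ)X)`, `V₀ = gaugeAct u V`. [cite: Balaban1985Averaging, (9) p.19] -/
theorem conjR_gaugeAct_conjR (u : Zd d → (Matrix (Fin N) (Fin N) ℂ)ˣ) (V : Zd d → Fin d → (Matrix (Fin N) (Fin N) ℂ)ˣ) (y : Zd d) (μ : Fin d)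
    (X : Matrix (Fin N) (Fin N) ℂ) :
    conjR (gaugeAct u V y μ) (conjR (u (y + unitVec μ)) X) = conjR (u y) (conjR (V y μ) X) := by
  rw [conjR_conjR, conjR_conjR, gaugeAct, unitVec_eq_e, inv_mul_cancel_right]

/-- The inverse transport at a gauged bond: `R(V₀ (y−e_μ) μ)⁻¹(R(u(y−e_μ))X) = R(u y)(R(V(y−e_μ) μ)⁻¹X)`. [cite: Balaban1985Averaging, (9) p.19] -/
theorem conjR_gaugeAct_inv_conjR (u : Zd d → (Matrix (Fin N) (Fin N) ℂ)ˣ) (V : Zd d → Fin d → (Matrix (Fin N) (Fin N) ℂ)ˣ) (y : Zd d) (μ : Fin d)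
    (X : Matrix (Fin N) (Fin N) ℂ) :
    conjR (gaugeAct u V (y - unitVec μ) μ)⁻¹ (conjR (u (y - unitVec μ)) X) = conjR (u y) (conjR (V (y - unitVec μ) μ)⁻¹ X) := by
  rw [conjR_conjR, conjR_conjR, gaugeAct, unitVec_eq_e, sub_add_cancel, mul_inv_rev, mul_inv_rev, inv_inv, mul_assoc, inv_mul_cancel_right]

variable (u : Zd d → (Matrix (Fin N) (Fin N) ℂ)ˣ) (V : Zd d → Fin d → (Matrix (Fin N) (Fin N) ℂ)ˣ) (g : Zd d → Fin d → Matrix (Fin N) (Fin N) ℂ)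

/-- ★ **THE COVARIANT CURL IS GAUGE COVARIANT**: with `V₀ = gaugeAct u V`, `g₀ y μ = R(u y)(g y μ)`,
`g₀ y μ + R(V₀ y μ)g₀(y+e_μ) ν − R(V₀ y ν)g₀(y+e_ν) μ − g₀ y ν = R(u y)(g y μ + R(V y μ)g(y+e_μ) ν − R(V y ν)g(y+e_ν) μ − g y ν)`. [cite: Balaban1985BackgroundPropagators, (3.9) p.392] -/
theorem covCurl_gauged (y : Zd d) (μ ν : Fin d) :
    conjR (u y) (g y μ) + conjR (gaugeAct u V y μ) (conjR (u (y + unitVec μ)) (g (y + unitVec μ) ν))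
        - conjR (gaugeAct u V y ν) (conjR (u (y + unitVec ν)) (g (y + unitVec ν) μ)) - conjR (u y) (g y ν)
      = conjR (u y) (g y μ + conjR (V y μ) (g (y + unitVec μ) ν) - conjR (V y ν) (g (y + unitVec ν) μ) - g y ν) := by
  rw [conjR_gaugeAct_conjR, conjR_gaugeAct_conjR, conjR_sub, conjR_sub, conjR_add]

/-- ★ **THE COVARIANT GRAPH DIVERGENCE IS GAUGE COVARIANT**: `Σ_μ (R(V₀(y−e_μ) μ)⁻¹ g₀(y−e_μ) μ − g₀ y μ) = R(u y)(Σ_μ (R(V(y−e_μ) μ)⁻¹ g(y−e_μ) μ − g y μ))`.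
[cite: Balaban1985BackgroundPropagators, (3.8) p.392] -/
theorem covDiv_gauged (y : Zd d) :
    ∑ μ, (conjR (gaugeAct u V (y - unitVec μ) μ)⁻¹ (conjR (u (y - unitVec μ)) (g (y - unitVec μ) μ)) - conjR (u y) (g y μ))
      = conjR (u y) (∑ μ, (conjR (V (y - unitVec μ) μ)⁻¹ (g (y - unitVec μ) μ) - g y μ)) := by
  rw [conjR_sum]
  exact Finset.sum_congr rfl fun μ _ => by rw [conjR_gaugeAct_inv_conjR, conjR_sub]

end Gauge

/-! ## §2 The axial-gauge bond bound on the box -/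

section Axial

/-- `Q_R(z)` is the order interval `[z − R, z + R]` of `ℤᵈ`. [folklore] [cite: Giaquinta1984, Ch. III §1 p.64] -/
theorem mem_box_iff_le (z y : Zd d) (R : ℤ) : y ∈ box z R ↔ (fun i => z i - R) ≤ y ∧ y ≤ (fun i => z i + R) := by
  rw [mem_box]
  constructor
  · intro h
    refine ⟨fun i => ?_, fun i => ?_⟩ <;> have := abs_le.1 (h i) <;> simp only <;> linarith [this.1, this.2]
  · rintro ⟨h1, h2⟩ i
    have a := h1 i; have b := h2 i
    simp only at a b
    rw [abs_le]; constructor <;> linarith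

/-- `l1` of a vector with coordinates in `[0, 2R]` is at most `d·2R`. [folklore] -/
theorem l1_le_of_le {v : Zd d} {R : ℤ} (hv0 : 0 ≤ v) (hv : v ≤ fun _ => 2 * R) : (l1 v : ℝ) ≤ d * (2 * R) := by
  unfold l1
  push_cast
  calc ∑ κ, ((v κ).natAbs : ℝ) ≤ ∑ _κ : Fin d, (2 * (R : ℝ)) := Finset.sum_le_sum fun κ _ => by
          have h0 : 0 ≤ v κ := hv0 κ
          have h1 : v κ ≤ 2 * R := hv κ
          have hr : ((v κ).natAbs : ℝ) = ((v κ : ℤ) : ℝ) := by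
            rw [Nat.cast_natAbs, Int.cast_abs]
            exact abs_of_nonneg (by exact_mod_cast h0)
          rw [hr]; exact_mod_cast h1
    _ = d * (2 * R) := by simp

/-- ★ **THE AXIAL GAUGE AT THE BOX CORNER HAS SMALL BOND VARIABLES ON THE BOX**: if the plaquettes of `V` inside `Q_R(z) = [z−R, z+R]` are `α`-close to `1` (lit `PlaqSmall`), then the
axial gauge `V₀ = gaugeAct (axialFn V (z−R)) V` satisfies `‖V₀ y μ − 1‖ ≤ 2dR·α` on every bond of the box. [cite: Balaban1985Averaging, pp.24-25; Balaban1985RegularSpaces, (1.7) p.77] -/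
theorem norm_axial_sub_one_le_of_plaqSmall [NeZero N] {z : Zd d} {R : ℤ} {α : ℝ} (hα : 0 ≤ α)
    (V : Zd d → Fin d → (Matrix (Fin N) (Fin N) ℂ)ˣ) (hV : ∀ y μ, V y μ ∈ U1 (Matrix (Fin N) (Fin N) ℂ))
    (hP : PlaqSmall V (fun i => z i - R) (fun i => z i + R) α)
    (y : Zd d) (μ : Fin d) (hy : y ∈ box z R) (hyμ : y + unitVec μ ∈ box z R) :
    ‖((gaugeAct (axialFn V (fun i => z i - R)) V y μ : (Matrix (Fin N) (Fin N) ℂ)ˣ) : Matrix (Fin N) (Fin N) ℂ) - 1‖ ≤ 2 * d * R * α := by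
  obtain ⟨hlo, hhi⟩ := (mem_box_iff_le z y R).1 hy
  obtain ⟨_, hhi'⟩ := (mem_box_iff_le z _ R).1 hyμ
  have h := axial_bond_bound_sharp V hV hP (fun i => z i - R) y μ le_rfl hlo (by rwa [← unitVec_eq_e])
  refine h.trans ?_
  have hv0 : 0 ≤ y - (fun i => z i - R) := sub_nonneg.2 hlo
  have h1 : (l1 (lowPart μ (y - fun i => z i - R)) : ℝ) ≤ (l1 (y - fun i => z i - R) : ℝ) := by
    have : l1 (lowPart μ (y - fun i => z i - R)) ≤ l1 (y - fun i => z i - R) := by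
      rw [B8Lemma1NonAbelian.l1_lowPart_eq]
      unfold l1
      exact Finset.sum_le_sum fun κ _ => by split_ifs <;> simp
    exact_mod_cast this
  have h2 : (l1 (y - fun i => z i - R) : ℝ) ≤ d * (2 * R) :=
    l1_le_of_le hv0 (fun i => by have := hhi i; simp only [Pi.sub_apply] at this ⊢; linarith)
  nlinarith

end Axial

/-! ## §3 The (B1′) brick: the covariant box Friedrichs inequality from the plaquette bound -/

section Main

variable [NeZero N]

/-- ★★★ **(B1′) THE COVARIANT BOX FRIEDRICHS INEQUALITY FROM THE PLAQUETTE BOUND** (skeleton `boxFriedrichs_curved`, ℤᵈ letters): `0 ≤ R`, `V` unitary with every plaquette inside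
`Q_R(z) = [z−R, z+R]` `α`-close to `1` (`PlaqSmall`), `0 ≤ α`, `g` an `M_N(ℂ)`-valued one-form living on the edges of `Q_R(z)`.  Then, with the covariant curl
`g y μ + R(V y μ)g(y+e_μ) ν − R(V y ν)g(y+e_ν) μ − g y ν` over the INSIDE plaquettes and the covariant graph divergence `Σ_μ (R(V(y−e_μ) μ)⁻¹ g(y−e_μ) μ − g y μ)`:
`Σ_{Q_R}Σ_μ‖g y μ‖² ≤ N(2R+1)²·((3∕2)·CURL + 2·DIV) + 80·d³·N·(2R+1)²·R²·α²·Σ_{Q_R}Σ_μ‖g y μ‖²` — absolute constants; the consumer absorbs the last term for `R²α` small.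
[cite: Balaban1984PropagatorsI, Prop. 1.1 p.33, (1.21) p.21; Balaban1985Averaging, pp.24-25; Balaban1985RegularSpaces, (1.7) p.77; Balaban1985BackgroundPropagators, (3.8)-(3.9) p.392] -/
theorem sum_sq_le_box_friedrichs_plaq {z : Zd d} {R : ℤ} (hR : 0 ≤ R) {α : ℝ} (hα : 0 ≤ α)
    (V : Zd d → Fin d → (Matrix (Fin N) (Fin N) ℂ)ˣ) (hV : ∀ y μ, V y μ ∈ U1 (Matrix (Fin N) (Fin N) ℂ))
    (hP : PlaqSmall V (fun i => z i - R) (fun i => z i + R) α)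
    (g : Zd d → Fin d → Matrix (Fin N) (Fin N) ℂ)
    (hg : ∀ (y : Zd d) (μ : Fin d), (y ∉ box z R ∨ y + unitVec μ ∉ box z R) → g y μ = 0) :
    ∑ y ∈ box z R, ∑ μ, ‖g y μ‖ ^ 2
      ≤ N * (2 * (R : ℝ) + 1) ^ 2 *
          ((3 / 2) * ∑ y ∈ box z R, ∑ μ, ∑ ν,
              (if y + unitVec μ + unitVec ν ∈ box z R then
                ‖g y μ + conjR (V y μ) (g (y + unitVec μ) ν) - conjR (V y ν) (g (y + unitVec ν) μ) - g y ν‖ ^ 2 else 0)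
            + 2 * ∑ y ∈ box z R, ‖∑ μ, (conjR (V (y - unitVec μ) μ)⁻¹ (g (y - unitVec μ) μ) - g y μ)‖ ^ 2)
        + 80 * d ^ 3 * N * (2 * (R : ℝ) + 1) ^ 2 * R ^ 2 * α ^ 2 * ∑ y ∈ box z R, ∑ μ, ‖g y μ‖ ^ 2 := by
  -- the axial gauge at the box corner
  set u : Zd d → (Matrix (Fin N) (Fin N) ℂ)ˣ := axialFn V (fun i => z i - R) with hu
  set V₀ : Zd d → Fin d → (Matrix (Fin N) (Fin N) ℂ)ˣ := gaugeAct u V with hV₀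
  set g₀ : Zd d → Fin d → Matrix (Fin N) (Fin N) ℂ := fun y μ => conjR (u y) (g y μ) with hg₀
  have hum : ∀ y, u y ∈ U1 (Matrix (Fin N) (Fin N) ℂ) := fun y => axialFn_mem hV _ y
  have hV₀m : ∀ y μ, V₀ y μ ∈ U1 (Matrix (Fin N) (Fin N) ℂ) := fun y μ => gaugeAct_mem hV hum y μ
  have hVθ : ∀ (y : Zd d) (μ : Fin d), y ∈ box z R → y + unitVec μ ∈ box z R →
      ‖(V₀ y μ : Matrix (Fin N) (Fin N) ℂ) - 1‖ ≤ 2 * d * R * α :=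
    fun y μ hy hyμ => norm_axial_sub_one_le_of_plaqSmall hα V hV hP y μ hy hyμ
  have hg₀s : ∀ (y : Zd d) (μ : Fin d), (y ∉ box z R ∨ y + unitVec μ ∉ box z R) → g₀ y μ = 0 := by
    intro y μ h; simp only [hg₀, hg y μ h, conjR_apply, mul_zero, zero_mul]
  -- the small-bond inequality in the axial gauge
  have h := sum_sq_le_box_friedrichs_cov hR V₀ hV₀m hVθ g₀ hg₀s
  -- transport back: norms, curls, divergences
  have e1 : ∑ y ∈ box z R, ∑ μ, ‖g₀ y μ‖ ^ 2 = ∑ y ∈ box z R, ∑ μ, ‖g y μ‖ ^ 2 :=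
    Finset.sum_congr rfl fun y _ => Finset.sum_congr rfl fun μ _ => by rw [hg₀, norm_conjR (hum y)]
  have e2 : ∑ y ∈ box z R, ∑ μ, ∑ ν,
        (if y + unitVec μ + unitVec ν ∈ box z R then
          ‖g₀ y μ + conjR (V₀ y μ) (g₀ (y + unitVec μ) ν) - conjR (V₀ y ν) (g₀ (y + unitVec ν) μ) - g₀ y ν‖ ^ 2 else (0 : ℝ))
      = ∑ y ∈ box z R, ∑ μ, ∑ ν,
        (if y + unitVec μ + unitVec ν ∈ box z R then
          ‖g y μ + conjR (V y μ) (g (y + unitVec μ) ν) - conjR (V y ν) (g (y + unitVec ν) μ) - g y ν‖ ^ 2 else 0) := by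
    refine Finset.sum_congr rfl fun y _ => Finset.sum_congr rfl fun μ _ => Finset.sum_congr rfl fun ν _ => ?_
    rw [hg₀, hV₀, covCurl_gauged u V g y μ ν, norm_conjR (hum y)]
  have e3 : ∑ y ∈ box z R, ‖∑ μ, (conjR (V₀ (y - unitVec μ) μ)⁻¹ (g₀ (y - unitVec μ) μ) - g₀ y μ)‖ ^ 2
      = ∑ y ∈ box z R, ‖∑ μ, (conjR (V (y - unitVec μ) μ)⁻¹ (g (y - unitVec μ) μ) - g y μ)‖ ^ 2 := by
    refine Finset.sum_congr rfl fun y _ => ?_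
    rw [hg₀, hV₀, covDiv_gauged u V g y, norm_conjR (hum y)]
  rw [e1, e2, e3] at h
  have e4 : 20 * (d : ℝ) * N * (2 * (R : ℝ) + 1) ^ 2 * (2 * d * R * α) ^ 2 = 80 * d ^ 3 * N * (2 * (R : ℝ) + 1) ^ 2 * R ^ 2 * α ^ 2 := by ring
  rw [e4] at h
  exact h

end Main

end Summit.QuantumFields.YangMills.Theorems.Prop7LatticeBoxFriedrichsCurved

end
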